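import Mathlib.Tactic
import HarnessLib
import HarnessLib.Audit.Tags
import Summits.CriticalPhenomena.PercolationContinuityZ3.Theorems.PercNearOneGluingNoHeavyLowerTailSahiAntichainDaykinRect
import Summits.CriticalPhenomena.PercolationContinuityZ3.Theorems.PercNearOneGluingNoHeavyLowerTailSahiAntichainFourSeven
import Summits.CriticalPhenomena.PercolationContinuityZ3.Theorems.PercNearOneGluingNoHeavyLowerTailSahiAntichainSplitEight
import Summits.CriticalPhenomena.PercolationContinuityZ3.Theorems.PercNearOneGluingNoHeavyLowerTailSahiAntichainThreeCoFour

/-!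
# Antichains, meets plus joins: two members above a four-member (co)sunflower create three new labels

Support file (seat `prim-masterthm-p1`, gen 37; `--supports stmt-CriticalPhenomena-4575`).  No `sorry`, no new definitions, standard
axioms.  Memo `run/shared/lean/prim/prim-masterthm/FROM-prim-masterthm-p1-g37-LINEAR-REDUCTION.md` §8 (towards lemma L4 / C6).

SETTING: V5 is reduced to L3 (`f(5) ≥ 10`) and L4 (six-member sides with at most eleven labels create four new labels, `…TwoLemmas`).
L4 needs the classification of six-member antichains with few labels; its first step is to show that no six-member antichain has exactly
eleven labels, and at a `2 + 4` point this requires three new labels opposite a four-member (co)sunflower (`2 + 7 + newLabels ≥ 12`).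

NEW HERE ([this work], gen 37).
* `four_le_newLabels_of_two_sunflower_four`: two members above, a four-member SUNFLOWER below ⟹ `newLabels ≥ 4` (Daykin on the cross
  rectangle: `#X · #Y ≥ 8`, one old meet, one old join).
* `three_le_newLabels_of_two_cofour`: two members above, a four-member CO-SUNFLOWER below ⟹ `newLabels ≥ 3` — the E3c toolkit of
  `…ThreeCoFour` verbatim (two members above form a co-sunflower trivially, so «all cross joins old» yields four new meets; an old cross meet
  yields two new meets; constant cross meets yield four new joins).  Exhaustive data (`2^6`): `newLabels ≥ 8` resp. `≥ 6` in these
  configurations.  Duals (four-member (co)sunflower above, two members below) by complementation.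
* `three_le_newLabels_of_one_cofour`, `ten_le_of_one_four` / `ten_le_of_four_one`: the `1 + 4` and `4 + 1` points of a five-member antichain
  already give ten labels; hence `ten_le_of_card_eq_five_of`: **L3 follows from a single statement about `2 + 3` points**
  (`f (three-side) + newLabels ≥ 8`; kernel: 7; data: 8, tight on the `C([4],2)` blow-ups minus a member).
HONEST FRAMING: unconditional lemmas; L3, L4 and V5 remain OPEN. [this work]
-/

namespace Summit.CriticalPhenomena.PercolationContinuityZ3.Theorems.SahiColouredDaykin

open Finset

variable {α : Type*} [DecidableEq α]

/-- Two members have at most one pairwise join. [this work] -/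
theorem card_joins_le_one_of_card_eq_two {A : Finset (Finset α)} (h2 : #A = 2) : #(joins A) ≤ 1 := by
  obtain ⟨a, a', haa, rfl⟩ := card_eq_two.1 h2
  apply card_le_one.2
  intro W hW W' hW'
  obtain ⟨x, hx, y, hy, hxy, rfl⟩ := mem_joins_iff.1 hW
  obtain ⟨x', hx', y', hy', hxy', rfl⟩ := mem_joins_iff.1 hW'
  simp only [mem_insert, mem_singleton] at hx hy hx' hy'
  rcases hx with rfl | rfl <;> rcases hy with rfl | rfl <;> rcases hx' with rfl | rfl <;> rcases hy' with rfl | rfl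
  all_goals first | exact absurd rfl hxy | exact absurd rfl hxy' | simp [union_comm]

/-- Two members above form a co-sunflower (all pairwise joins equal). [this work] -/
theorem exists_union_eq_of_card_above_eq_two {P : Finset (Finset α)} {r : α} (h2 : #(above P r) = 2) :
    ∃ V, ∀ a ∈ above P r, ∀ a' ∈ above P r, a ≠ a' → a ∪ a' = V := by
  obtain ⟨a, a', haa, hA⟩ := card_eq_two.1 h2
  refine ⟨a ∪ a', fun x hx y hy hxy => ?_⟩
  rw [hA, mem_insert, mem_singleton] at hx hy
  rcases hx with rfl | rfl <;> rcases hy with rfl | rfl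
  · exact absurd rfl hxy
  · rfl
  · exact union_comm _ _
  · exact absurd rfl hxy

/-- **Two above, four-member sunflower below ⟹ four new labels** (Daykin). [this work] -/
theorem four_le_newLabels_of_two_sunflower_four {P : Finset (Finset α)} {r : α} {K : Finset α}
    (h2 : #(above P r) = 2) (h4 : #(below P r) = 4) (hK : ∀ b ∈ below P r, ∀ b' ∈ below P r, b ≠ b' → b ∩ b' = K) :
    4 ≤ newLabels P r := by
  have hD := card_above_mul_card_below_le P r
  rw [h2, h4] at hD
  have hc := card_crossMeets_add_card_crossJoins_le P r
  have hL := card_meets_le_one_of_sunflower hK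
  have hJ := card_joins_le_one_of_card_eq_two h2
  -- `#X · #Y ≥ 8` forces `#X + #Y ≥ 6`
  have h6 : 6 ≤ #(crossMeets P r) + #(crossJoins P r) := by
    by_contra hlt
    have hx : #(crossMeets P r) ≤ 5 := by omega
    have hy : #(crossJoins P r) ≤ 5 := by omega
    interval_cases (#(crossMeets P r)) <;> interval_cases (#(crossJoins P r)) <;> omega
  omega

/-- **Two above, four-member co-sunflower below ⟹ three new labels** (the E3c toolkit). [this work] -/
theorem three_le_newLabels_of_two_cofour {P : Finset (Finset α)} {r : α} {U : Finset α}
    (hanti : IsAntichain (· ⊆ ·) (P : Set (Finset α))) (h2 : #(above P r) = 2) (h4 : #(below P r) = 4)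
    (hU : ∀ b ∈ below P r, ∀ b' ∈ below P r, b ≠ b' → b ∪ b' = U) : 3 ≤ newLabels P r := by
  have hA2 : 1 < #(above P r) := by omega
  have hB2 : 1 < #(below P r) := by omega
  have hA : (above P r).Nonempty := card_pos.1 (by omega)
  have hB : (below P r).Nonempty := card_pos.1 (by omega)
  obtain ⟨V, hV⟩ := exists_union_eq_of_card_above_eq_two h2
  unfold newLabels
  have hY : 1 ≤ #(newJoins P r) ∨ 4 ≤ #(newMeets P r) := by
    by_cases h0 : newJoins P r = ∅
    · have := card_below_le_card_newMeets_of_cosunflower hanti hA2 hV h0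
      omega
    · exact Or.inl (card_pos.2 (nonempty_iff_ne_empty.2 h0))
  have hX : 2 ≤ #(newMeets P r) ∨ 4 ≤ #(newJoins P r) := by
    by_cases hold : ∃ a ∈ above P r, ∃ b ∈ below P r, a ∩ b ∈ meets (below P r)
    · obtain ⟨a, ha, b, hb, hmem⟩ := hold
      obtain ⟨d, hd, d', hd', hdd', heq⟩ := mem_meets_iff.1 hmem
      exact Or.inl (two_le_card_newMeets_of_cofour hanti hU h4 ha hd hd' hdd' (by rw [← heq]; exact inter_subset_left))
    · push Not at hold
      have hXN : crossMeets P r ⊆ newMeets P r := by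
        intro Z hZ
        obtain ⟨a, haP, b, hbP, hra, hrb, rfl⟩ := mem_crossMeets_iff.1 hZ
        exact (inter_mem_newMeets_iff (mem_above_iff.2 ⟨haP, hra⟩) (mem_below_iff.2 ⟨hbP, hrb⟩)).2
          (hold a (mem_above_iff.2 ⟨haP, hra⟩) b (mem_below_iff.2 ⟨hbP, hrb⟩))
      by_cases hX1 : #(crossMeets P r) ≤ 1
      · obtain ⟨a, ha⟩ := hA
        obtain ⟨b₁, hb₁⟩ := hB
        obtain ⟨b₂, hb₂, h21⟩ := exists_mem_ne hB2 b₁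
        have := card_below_le_card_newJoins_of_crossMeets_le_one (U := U) hanti hX1 ha
          (fun b hb => subset_of_below_cosunflower hU hB2 hb) ⟨b₁, hb₁, b₂, hb₂, hU b₁ hb₁ b₂ hb₂ h21.symm⟩
        omega
      · have := card_le_card hXN
        omega
  rcases hY with hY | hY <;> rcases hX with hX | hX <;> omega

/-- `2 + 4` with a (co)sunflower four-side below, stated with `#meets + #joins ≤ 7` (cf. `…FourSeven`): three new labels. [this work] -/
theorem three_le_newLabels_of_two_four_le_seven {P : Finset (Finset α)} {r : α} (hanti : IsAntichain (· ⊆ ·) (P : Set (Finset α)))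
    (h2 : #(above P r) = 2) (h4 : #(below P r) = 4) (hf : #(meets (below P r)) + #(joins (below P r)) ≤ 7) : 3 ≤ newLabels P r := by
  rcases sunflower_or_cosunflower_of_card_eq_four (isAntichain_below hanti r) h4 hf with ⟨K, hK⟩ | ⟨U, hU⟩
  · have := four_le_newLabels_of_two_sunflower_four h2 h4 hK; omega
  · exact three_le_newLabels_of_two_cofour hanti h2 h4 hU

/-- Dually: `4 + 2` with a (co)sunflower four-side above: three new labels (complementation). [this work] -/
theorem three_le_newLabels_of_four_le_seven_two {P : Finset (Finset α)} {r : α} (hanti : IsAntichain (· ⊆ ·) (P : Set (Finset α)))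
    (h4 : #(above P r) = 4) (h2 : #(below P r) = 2) (hf : #(meets (above P r)) + #(joins (above P r)) ≤ 7) : 3 ≤ newLabels P r := by
  set F := insert r (P.sup id) with hF
  have hP : ∀ a ∈ P, a ⊆ F := subset_insert_sup P r
  have hPA : ∀ a ∈ above P r, a ⊆ F := fun a ha => hP a (above_subset P r ha)
  have hr : r ∈ F := mem_insert_self _ _
  rw [← newLabels_image_compl hP hr]
  refine three_le_newLabels_of_two_four_le_seven (isAntichain_image_compl hanti hP)
    (by rw [card_above_image_compl hP hr]; exact h2) (by rw [card_below_image_compl hP hr]; exact h4) ?_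
  rw [below_image_compl (P := P) hr, card_meets_add_card_joins_image_compl hPA]
  exact hf

/-- Consequence for six members: at an effective `2 + 4` or `4 + 2` point of a six-member antichain, `#meets + #joins ≥ 12` unless the
four-side has at least eight labels of its own — in all cases `f ≥ 12` there; so a six-member antichain with at most eleven labels has only
`3 + 3` effective points (the `1 + 5` points need L3 and are treated with it). [this work] -/
theorem twelve_le_of_two_four {P : Finset (Finset α)} {r : α} (hanti : IsAntichain (· ⊆ ·) (P : Set (Finset α)))
    (h2 : #(above P r) = 2) (h4 : #(below P r) = 4) : 12 ≤ #(meets P) + #(joins P) := by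
  have hsplit := card_meets_add_card_joins_split P r
  have h7 := seven_le_of_card_eq_four (isAntichain_below hanti r) h4
  have vA := two_mul_card_le_of_card_le_three (above P r) (isAntichain_above hanti r) (by omega)
  have hA : (above P r).Nonempty := card_pos.1 (by omega)
  have hB : (below P r).Nonempty := card_pos.1 (by omega)
  have c2 := two_le_newLabels_of_min_le_two hanti hA hB (Or.inl (by omega))
  by_cases hf : #(meets (below P r)) + #(joins (below P r)) ≤ 7
  · have c3 := three_le_newLabels_of_two_four_le_seven hanti h2 h4 hf
    omega
  · omega

/-- Dually for `4 + 2` points. [this work] -/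
theorem twelve_le_of_four_two {P : Finset (Finset α)} {r : α} (hanti : IsAntichain (· ⊆ ·) (P : Set (Finset α)))
    (h4 : #(above P r) = 4) (h2 : #(below P r) = 2) : 12 ≤ #(meets P) + #(joins P) := by
  have hsplit := card_meets_add_card_joins_split P r
  have h7 := seven_le_of_card_eq_four (isAntichain_above hanti r) h4
  have vB := two_mul_card_le_of_card_le_three (below P r) (isAntichain_below hanti r) (by omega)
  have hA : (above P r).Nonempty := card_pos.1 (by omega)
  have hB : (below P r).Nonempty := card_pos.1 (by omega)
  have c2 := two_le_newLabels_of_min_le_two hanti hA hB (Or.inr (by omega))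
  by_cases hf : #(meets (above P r)) + #(joins (above P r)) ≤ 7
  · have c3 := three_le_newLabels_of_four_le_seven_two hanti h4 h2 hf
    omega
  · omega


/-! ### One member above a four-member co-sunflower; the `1 + 4` points of five-member antichains; L3 reduced to its `2 + 3` points -/

/-- **One above, four-member co-sunflower below ⟹ three new labels** (E3c toolkit; all cross joins are new here). [this work] -/
theorem three_le_newLabels_of_one_cofour {P : Finset (Finset α)} {r : α} {U : Finset α}
    (hanti : IsAntichain (· ⊆ ·) (P : Set (Finset α))) (h1 : #(above P r) = 1) (h4 : #(below P r) = 4)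
    (hU : ∀ b ∈ below P r, ∀ b' ∈ below P r, b ≠ b' → b ∪ b' = U) : 3 ≤ newLabels P r := by
  have hB2 : 1 < #(below P r) := by omega
  have hA : (above P r).Nonempty := card_pos.1 (by omega)
  have hB : (below P r).Nonempty := card_pos.1 (by omega)
  unfold newLabels
  -- a cross join exists and is new (no joins above)
  have hY : 1 ≤ #(newJoins P r) := by
    obtain ⟨a, ha⟩ := hA
    obtain ⟨b, hb⟩ := hB
    have hJ : joins (above P r) = ∅ := joins_eq_empty_of_card_le_one (by omega)
    have : a ∪ b ∈ newJoins P r := by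
      rw [union_mem_newJoins_iff ha hb, hJ]; exact notMem_empty _
    exact card_pos.2 ⟨_, this⟩
  have hX : 2 ≤ #(newMeets P r) ∨ 4 ≤ #(newJoins P r) := by
    by_cases hold : ∃ a ∈ above P r, ∃ b ∈ below P r, a ∩ b ∈ meets (below P r)
    · obtain ⟨a, ha, b, hb, hmem⟩ := hold
      obtain ⟨d, hd, d', hd', hdd', heq⟩ := mem_meets_iff.1 hmem
      exact Or.inl (two_le_card_newMeets_of_cofour hanti hU h4 ha hd hd' hdd' (by rw [← heq]; exact inter_subset_left))
    · push Not at hold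
      have hXN : crossMeets P r ⊆ newMeets P r := by
        intro Z hZ
        obtain ⟨a, haP, b, hbP, hra, hrb, rfl⟩ := mem_crossMeets_iff.1 hZ
        exact (inter_mem_newMeets_iff (mem_above_iff.2 ⟨haP, hra⟩) (mem_below_iff.2 ⟨hbP, hrb⟩)).2
          (hold a (mem_above_iff.2 ⟨haP, hra⟩) b (mem_below_iff.2 ⟨hbP, hrb⟩))
      by_cases hX1 : #(crossMeets P r) ≤ 1
      · obtain ⟨a, ha⟩ := hA
        obtain ⟨b₁, hb₁⟩ := hB
        obtain ⟨b₂, hb₂, h21⟩ := exists_mem_ne hB2 b₁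
        have := card_below_le_card_newJoins_of_crossMeets_le_one (U := U) hanti hX1 ha
          (fun b hb => subset_of_below_cosunflower hU hB2 hb) ⟨b₁, hb₁, b₂, hb₂, hU b₁ hb₁ b₂ hb₂ h21.symm⟩
        omega
      · have := card_le_card hXN
        omega
  rcases hX with hX | hX <;> omega

/-- **`1 + 4` points of a five-member antichain have `f ≥ 10`**: the four-side has eight labels (`…FourSeven`) and the one-sided step gives
two more, or it is a (co)sunflower with seven and the point creates three. [this work] -/
theorem ten_le_of_one_four {P : Finset (Finset α)} {r : α} (hanti : IsAntichain (· ⊆ ·) (P : Set (Finset α)))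
    (h1 : #(above P r) = 1) (h4 : #(below P r) = 4) : 10 ≤ #(meets P) + #(joins P) := by
  have hsplit := card_meets_add_card_joins_split P r
  have h7 := seven_le_of_card_eq_four (isAntichain_below hanti r) h4
  have hP : #P = 5 := by have := card_above_add_card_below P r; omega
  have c2 := two_le_newLabels_of_card_above_eq_one hanti (by omega) h1
  by_cases hf : #(meets (below P r)) + #(joins (below P r)) ≤ 7
  · rcases sunflower_or_cosunflower_of_card_eq_four (isAntichain_below hanti r) h4 hf with ⟨K, hK⟩ | ⟨U, hU⟩
    · have := three_le_newLabels_of_one_sunflower hanti h1 (by omega) hK; omega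
    · have := three_le_newLabels_of_one_cofour hanti h1 h4 hU; omega
  · omega

/-- Dually, **`4 + 1` points of a five-member antichain have `f ≥ 10`**. [this work] -/
theorem ten_le_of_four_one {P : Finset (Finset α)} {r : α} (hanti : IsAntichain (· ⊆ ·) (P : Set (Finset α)))
    (h4 : #(above P r) = 4) (h1 : #(below P r) = 1) : 10 ≤ #(meets P) + #(joins P) := by
  set F := insert r (P.sup id) with hF
  have hP : ∀ a ∈ P, a ⊆ F := subset_insert_sup P r
  have hr : r ∈ F := mem_insert_self _ _
  rw [← card_meets_add_card_joins_image_compl hP]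
  exact ten_le_of_one_four (isAntichain_image_compl hanti hP) (by rw [card_above_image_compl hP hr]; exact h1)
    (by rw [card_below_image_compl hP hr]; exact h4)

/-- **L3 reduced to its `2 + 3` points.**  If at every `2 + 3` point the three-side's own labels plus the new labels number at least
eight (kernel: at least seven — `…SplitTwoThree`, `…SplitTwo`; needed: `4 + 4` for a (co)sunflower triple, `5 + 3` for a triple with five
labels), then every five-member antichain has at least ten labels. [this work] -/
theorem ten_le_of_card_eq_five_of
    (h23 : ∀ (P : Finset (Finset α)) (r : α), IsAntichain (· ⊆ ·) (P : Set (Finset α)) → #(above P r) = 2 → #(below P r) = 3 →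
      8 ≤ #(meets (below P r)) + #(joins (below P r)) + newLabels P r)
    {P : Finset (Finset α)} (hanti : IsAntichain (· ⊆ ·) (P : Set (Finset α))) (h5 : #P = 5) : 10 ≤ #(meets P) + #(joins P) := by
  -- the dual `3 + 2` statement, by complementation
  have h32 : ∀ (P : Finset (Finset α)) (r : α), IsAntichain (· ⊆ ·) (P : Set (Finset α)) → #(above P r) = 3 → #(below P r) = 2 →
      8 ≤ #(meets (above P r)) + #(joins (above P r)) + newLabels P r := by
    intro P r hanti h3 h2
    set F := insert r (P.sup id) with hF
    have hP : ∀ a ∈ P, a ⊆ F := subset_insert_sup P r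
    have hPA : ∀ a ∈ above P r, a ⊆ F := fun a ha => hP a (above_subset P r ha)
    have hr : r ∈ F := mem_insert_self _ _
    have := h23 (P.image (F \ ·)) r (isAntichain_image_compl hanti hP) (by rw [card_above_image_compl hP hr]; exact h2)
      (by rw [card_below_image_compl hP hr]; exact h3)
    rw [newLabels_image_compl hP hr, below_image_compl (P := P) hr, card_meets_add_card_joins_image_compl hPA] at this
    exact this
  obtain ⟨r, hr⟩ := effPoints_nonempty (by omega : 2 ≤ #P)
  obtain ⟨hA, hB⟩ := mem_effPoints_iff.1 hr
  have hcard := card_above_add_card_below P r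
  have hApos : 0 < #(above P r) := card_pos.2 hA
  have hBpos : 0 < #(below P r) := card_pos.2 hB
  have hsplit := card_meets_add_card_joins_split P r
  by_cases hA1 : #(above P r) = 1
  · exact ten_le_of_one_four hanti hA1 (by omega)
  by_cases hB1 : #(below P r) = 1
  · exact ten_le_of_four_one hanti (by omega) hB1
  by_cases hA2 : #(above P r) = 2
  · have := h23 P r hanti hA2 (by omega)
    have vA := two_mul_card_le_of_card_le_three (above P r) (isAntichain_above hanti r) (by omega)
    omega
  · have hA3 : #(above P r) = 3 := by omega
    have := h32 P r hanti hA3 (by omega)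
    have vB := two_mul_card_le_of_card_le_three (below P r) (isAntichain_below hanti r) (by omega)
    omega

end Summit.CriticalPhenomena.PercolationContinuityZ3.Theorems.SahiColouredDaykin
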